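import Summits.HodgeConjecture.CorCM.MumfordTateRankFour
import Summits.HodgeConjecture.CorCM.CMAbelianFourfoldPowers
import Literature.AlgebraicGeometry.HodgeTheory.EllipticCurvesProductsHodgeClassesOfRiemann
import Literature.AlgebraicGeometry.ComplexMultiplication.FieldOfDegreeTwoDimIsotypic
import HarnessLib

/-!
# `dim MT(H¹(X)) = 4` and an elliptic isogeny factor: `X` is a power of a non-CM elliptic curve, and the Hodge
# conjecture holds for `X`

COR-CM (cell `pub-hodgecm2`, seat `b27` gen 30, count-neutral lane MT-RANK-FOUR, file 2 of the variety level; theorems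
only, no definition, no named fact; UNCONDITIONAL).  Sequel of `CorCM/MumfordTateRankFour`: there, a complex abelian
variety `X` NOT of CM type with `dim MT(H¹(X)) ≤ 4` is isogenous to a power `B^{m+1}` of ONE simple abelian variety `B`
(with `dim_ℚ End⁰(B) = (dim B)²`, `Z(End⁰ B) = ℚ`).  Classically `B` is a non-CM elliptic curve or a QM abelian surface
(Albert); without Albert's classification the tree still decides the elliptic case:

* `isIsogenous_powSucc_of_avDominatedBy_elliptic` — if moreover some ELLIPTIC CURVE `E` is an isogeny factor of `X`
  (`AVDominatedBy E X`: `s : E → X`, `π : X → E`, `s ≫ π = [N]`, `N ≠ 0`), then `X ∼ E^{m+1}` (uniqueness of the simple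
  isogeny factors, `exists_isIsogenous_of_isSimple_of_avDominatedBy_biproduct`) — so `E` is not of CM type and
  `dim MT(H¹(E)) = 4`, `End⁰(E) = ℚ`;
* **`hodgeConjectureFor_of_avDominatedBy_elliptic_of_mtRank_le_four`** — and then `B(X) = D(X) ⊗ ℂ`
  (`IsDivisorGenerated X`) and the **Hodge conjecture holds for `X`** (Tate / Imai / Murasaki: Hodge classes on a variety
  isogenous to a product of elliptic curves are generated by divisor classes — the tree's
  `isDivisorGenerated_of_isIsogenous_multiPowSucc_of_riemann` fed with Riemann's theorem
  `deligneMilne1982_Thm_6_20_full_holds`).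

With gen 29's `hodgeConjectureFor_powSucc_of_mtRank_le_three` (`dim MT ≤ 3`: CM, all powers) this settles the Hodge
conjecture for every complex abelian variety with `dim MT(H¹(X)) ≤ 4` that is of CM type or has an elliptic isogeny
factor; the remaining case `dim MT = 4` without elliptic factor is `X ∼ B^{m+1}`, `B` simple non-CM with
`dim End⁰(B) = (dim B)² ≥ 4` (classically a QM surface).

## References

* [MoonenZarhin1999LowDim] B. Moonen, Yu. Zarhin, *Hodge classes on abelian varieties of low dimension*, Math. Ann.
  315 (1999), §2 (2.1) (`Hg` of elliptic curves), Cor. (3.9) (products of elliptic curves satisfy (D)).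
* [vanGeemen1994HodgeAV] B. van Geemen, *An introduction to the Hodge conjecture for abelian varieties*, LNM 1594 (1994),
  Thm. 4.3 (Tate: `B = D` for varieties isogenous to products of elliptic curves).
* [MumfordAV1970] D. Mumford, *Abelian Varieties* (1970), §19 Thm. 1 Cor. 1 (uniqueness of simple isogeny factors).
-/

noncomputable section

open CategoryTheory CategoryTheory.Limits Module

namespace Summit.HodgeConjecture.CorCM

open Literature.AlgebraicGeometry.Motives
open Literature.AlgebraicGeometry.Motives.AbelianVariety
open Literature.AlgebraicGeometry.Motives.HodgeStructure
open Literature.AlgebraicGeometry.HodgeTheory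
open Literature.AlgebraicGeometry.ComplexMultiplication (isIsogenous_biproduct_powSucc)
open Literature.AlgebraicGeometry.Milne1999 (IsOfCMType isOfCMType_iff_of_isIsogenous isIsogeny_biproduct_map)
open Summit.HodgeConjecture.CorCM.Domination

variable [HodgeTensorFacts.{0, 0}] {X E : AbelianVariety ℂ} {n : ℕ}

/-- **`dim MT(H¹(X)) ≤ 4`, `X` not of CM type, and an elliptic isogeny factor `E ≼ X` ⟹ `X ∼ E^{m+1}`.**  By
`exists_isIsogenous_power_of_not_isOfCMType`, `X ∼ ⨁_{Fin (m+1)} B` with `B` simple; the elliptic curve `E` (simple,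
`isSimple_of_dim_le_one`) is an isogeny factor of `⨁ B`, hence `E ∼ B` (Mumford §19 Cor. 1, the tree's
`exists_isIsogenous_of_isSimple_of_avDominatedBy_biproduct`), and `⨁_{Fin (m+1)} B ∼ ⨁_{Fin (m+1)} E ≅ E^{m+1}`.
[cite: MumfordAV1970, §19 Thm. 1 Cor. 1] [cite: MoonenZarhin1999LowDim, §2] -/
theorem isIsogenous_powSucc_of_avDominatedBy_elliptic (hX : IsSmoothProjective n X.X) (h0 : 0 < X.dim)
    (hcm : ¬ IsOfCMType X)
    (h4 : haveI := BettiUniverse.finite hX 1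
      (BettiUniverse.hodge exists_isReal_hodgeModel_holds hX 1).mtRank ≤ 4)
    (hE1 : E.dim = 1) (hEX : AVDominatedBy E X) :
    ∃ m : ℕ, IsIsogenous X (E.powSucc m) ∧ X.dim = m + 1 ∧ ¬ IsOfCMType E := by
  obtain ⟨B, m, hS, hB, -, hXB, hdim, -, -⟩ := exists_isIsogenous_power_of_not_isOfCMType hX h0 hcm h4
  obtain ⟨f, hf⟩ := id hXB
  -- `E` is an isogeny factor of `⨁ B`, hence `E ∼ B`
  have hEB : AVDominatedBy E (⨁ fun _ : Fin (m + 1) => B) := hEX.trans_isIsogeny_hom hf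
  obtain ⟨-, g, hg⟩ := exists_isIsogenous_of_isSimple_of_avDominatedBy_biproduct (fun _ => hS)
    (isSimple_of_dim_le_one hE1.le) (by omega) hEB
  -- an isogeny `B → E` and `⨁ B ∼ ⨁ E ∼ E^{m+1}`
  obtain ⟨g', hg'⟩ := (IsIsogenous.symm' ⟨g, hg⟩ : IsIsogenous B E)
  have hBE : IsIsogenous (⨁ fun _ : Fin (m + 1) => B) (⨁ fun _ : Fin (m + 1) => E) :=
    ⟨biproduct.map fun _ => g', isIsogeny_biproduct_map fun _ => hg'⟩
  have hXE : IsIsogenous X (E.powSucc m) := (hXB.trans hBE).trans (isIsogenous_biproduct_powSucc E m)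
  refine ⟨m, hXE, ?_, fun hEcm => hcm ?_⟩
  · rw [hdim, dim_eq_of_isIsogeny hg', hE1, mul_one]
  · rw [isOfCMType_iff_of_isIsogenous (hXB.trans hBE), CMProductEnd.isOfCMType_biproduct_fin_iff]
    exact fun _ => hEcm

/-- **The Hodge conjecture for complex abelian varieties NOT of CM type with `dim MT(H¹(X)) ≤ 4` and an elliptic
isogeny factor**: such an `X` is isogenous to a power of an elliptic curve, so `B(X) = D(X) ⊗ ℂ` and the Hodge
conjecture holds for `X` (Tate / Imai; van Geemen Thm. 4.3; Moonen–Zarhin Cor. (3.9)) — through the tree's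
`isDivisorGenerated_of_isIsogenous_multiPowSucc_of_riemann` and Riemann's theorem `deligneMilne1982_Thm_6_20_full_holds`.
UNCONDITIONAL. [cite: vanGeemen1994HodgeAV, Thm. 4.3] [cite: MoonenZarhin1999LowDim, Cor. (3.9)] -/
theorem hodgeConjectureFor_of_avDominatedBy_elliptic_of_mtRank_le_four (hX : IsSmoothProjective n X.X)
    (h0 : 0 < X.dim) (hcm : ¬ IsOfCMType X)
    (h4 : haveI := BettiUniverse.finite hX 1
      (BettiUniverse.hodge exists_isReal_hodgeModel_holds hX 1).mtRank ≤ 4)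
    (hE1 : E.dim = 1) (hEX : AVDominatedBy E X) :
    IsDivisorGenerated X ∧ HodgeConjectureFor X.dim X.X := by
  obtain ⟨m, hXE, -, -⟩ := isIsogenous_powSucc_of_avDominatedBy_elliptic hX h0 hcm h4 hE1 hEX
  have hA : X.IsIsogenous (multiPowSucc 0 (fun _ => E) (fun _ => m)) := hXE
  exact ⟨isDivisorGenerated_of_isIsogenous_multiPowSucc_of_riemann deligneMilne1982_Thm_6_20_full_holds 0 _ _
      (fun _ => hE1) hA,
    hodgeConjectureFor_of_isIsogenous_multiPowSucc_of_riemann deligneMilne1982_Thm_6_20_full_holds 0 _ _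
      (fun _ => hE1) hA⟩

/-- The elliptic isogeny factor in the previous theorems is itself NOT of CM type, has `dim MT(H¹(E)) = 4` and
`End⁰(E) = ℚ` (`mtRank_hodge_one_eq_four_of_dim_one`, `finrank_endAlgebra_eq_one_of_dim_one`).
[cite: MoonenZarhin1999LowDim, §2 (2.1)] -/
theorem elliptic_factor_of_mtRank_le_four (hX : IsSmoothProjective n X.X) (h0 : 0 < X.dim) (hcm : ¬ IsOfCMType X)
    (h4 : haveI := BettiUniverse.finite hX 1
      (BettiUniverse.hodge exists_isReal_hodgeModel_holds hX 1).mtRank ≤ 4)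
    (hE1 : E.dim = 1) (hEX : AVDominatedBy E X) :
    haveI := BettiUniverse.finite (AbelianVariety.isSmoothProjective_holds (A := E)) 1
    ¬ IsOfCMType E ∧
      (BettiUniverse.hodge exists_isReal_hodgeModel_holds (AbelianVariety.isSmoothProjective_holds (A := E)) 1).mtRank
        = 4 ∧ Module.finrank ℚ E.endAlgebra = 1 := by
  obtain ⟨m, -, -, hEcm⟩ := isIsogenous_powSucc_of_avDominatedBy_elliptic hX h0 hcm h4 hE1 hEX
  exact ⟨hEcm, mtRank_hodge_one_eq_four_of_dim_one _ hE1 hEcm, finrank_endAlgebra_eq_one_of_dim_one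
    AbelianVariety.isSmoothProjective_holds hE1 hEcm⟩

end Summit.HodgeConjecture.CorCM

end
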